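import Summits.ResolutionOfSingularities.ResolutionOfSingularities.Theorems.PurelyInseparableDim4ChartAtlasSNCJacobian
import HarnessLib

/-!
# Purely inseparable four-folds `z^p + F(x₁, …, x₄)`: the FAR GOOD CHART — on the re-centred `x_j`-chart the escaping centre
# `V(y_0, y_T)` is snc with hyperplanes AND far quadrics of pairwise distinct heights (S3-N2 positive side; cell `res-dim4-pi`, typ-2 g6)

[OURS · counted 0] (D-0157 DOOR 2; DR-157-C; desk WORD #115 (a)/(c), #131 (c); typ-2 g5 HANDOFF OPEN item 1). The converse of FAR
RESONANCE (p699206/p699584) on the model of the re-centred `x_j`-chart (escaping case `j ∉ T`): the members of the transformed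
boundary read there (p697935 §1, p699206 §3) `⊤`, translated hyperplanes `(y_k + a)·𝒪` — `E₁ = {y_j = 0}`, near old members
`{yᵢ + bᵢ = 0}`, transversal old members, the far member `{y_j + d = 0}` — and the far QUADRICS `Qᵢ = ((yᵢ + bᵢ)·y_j + dᵢ)·𝒪`,
`dᵢ ≠ 0`, of the far old members `{xᵢ = -dᵢ}`, `i ∈ S ∖ {j}`. PROVED here (no `sorry`, no new axiom), with the hyperplanes indexed by
ANY finite set `H` of pairs `(k, a)` (parallel members allowed) and the quadrics by a finite set `fs ∌ j`:

* **`hasSNCWith_𝓘Λ_of_forall_mem_far`** — if (C1) a hyperplane of index `i ∈ fs` has constant `bᵢ` (the near member of that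
  index), (C2) NO far hyperplane `{y_j = -a}` has the height of an active quadric: `a·bᵢ ≠ dᵢ` for `i ∈ fs ∩ T`, `bᵢ ≠ 0`, and
  (C3) NO two active quadrics share a height: `dᵢ·b_k ≠ d_k·bᵢ` for `i ≠ k ∈ fs ∩ T`, `bᵢ, b_k ≠ 0` — then
  `HasSNCWith E (𝓘Λ 4 K ({0} ∪ T))` for every list `E` of such members.

Method: the Jacobian engine p-`…ChartAtlasSNCJacobian` (`hasSNCWith_𝓘Λ_of_jacobian`): a hyperplane `y_k + a` OWNS `y_k` (rank 0);
a quadric `Qᵢ` owns `y_j` (rank 1) when the centre passes through the point and `yᵢ` is a centre variable (then `∂Qᵢ/∂y_j = yᵢ + bᵢ`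
is a unit), and its private variable `yᵢ` (rank 2, `∂Qᵢ/∂yᵢ = y_j` a unit on `V(Qᵢ)`) otherwise; (C1)–(C3) are exactly what
makes two members of one family own different variables (`X_add_C_…`, `quadric_…` bookkeeping in §1). With p699206 this closes
the by-hand criterion of `S3-N2-SNC-CRITERION.md` §05:30Z on the `x_j`-chart. Nothing here is a statement about resolution of
singularities in dimension ≥ 4 / characteristic `p` (NOT proved anywhere in this programme). bears_on: LADDER-RESOLUTION:D157-DOOR2
(res-dim4-pi). Supports stmt-ResolutionOfSingularities-16155 (helper, S3-N2 positive side with far members).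
-/

-- every declaration of this summit lives under `Summit.ResolutionOfSingularities.ResolutionOfSingularities`
-- (summit = problem), which the duplicate-namespace linter flags; house convention (cf. the Target file).
set_option linter.dupNamespace false

noncomputable section

open MvPolynomial CategoryTheory AlgebraicGeometry Opposite TopologicalSpace
open AlgebraicGeometry.Scheme.IdealSheafData (ofIdealTop)

namespace Summit.ResolutionOfSingularities.ResolutionOfSingularities.Theorems.PIDim4

open Literature.AlgebraicGeometry.Resolution
open Literature.AlgebraicGeometry.Resolution.AffinePointBlowup (P A γ coord Wtop ξ)

namespace ChartDictionary

variable {K : Type} [Field K]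

/-! ## §1 Bookkeeping: the equations and their partial derivatives -/

section Bookkeeping

variable {n : ℕ}

/-- A non-zero constant does not lie in a prime of `K[y]`. -/
theorem C_mem_asIdeal_iff (x : P n K) (a : K) : (C a : A n K) ∈ x.asIdeal ↔ a = 0 := by
  constructor
  · intro h
    by_contra ha
    exact x.2.ne_top (Ideal.eq_top_of_isUnit_mem _ h ((Ne.isUnit ha).map C))
  · rintro rfl
    rw [C_0]
    exact x.asIdeal.zero_mem

/-- `∂(y_k + a)/∂y_m = [m = k]`. -/
theorem pderiv_X_add_C (m k : Fin (n + 1)) (a : K) :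
    pderiv m (X k + C a : A n K) = if m = k then 1 else 0 := by
  classical
  rw [map_add, pderiv_C, add_zero, pderiv_X, Pi.single_apply]
  by_cases h : m = k
  · rw [if_pos h, if_pos h.symm]
  · rw [if_neg h, if_neg (Ne.symm h)]

/-- Translated hyperplane equations are determined by their index and constant. -/
theorem X_add_C_eq_X_add_C_iff {k k' : Fin (n + 1)} {a a' : K} :
    (X k + C a : A n K) = X k' + C a' ↔ k = k' ∧ a = a' := by
  constructor
  · intro h
    have hk : k = k' := by
      by_contra hne
      have h1 := congrArg (pderiv k) h
      rw [pderiv_X_add_C, pderiv_X_add_C, if_pos rfl, if_neg hne] at h1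
      exact one_ne_zero h1
    subst hk
    exact ⟨rfl, C_injective _ _ (add_left_cancel h)⟩
  · rintro ⟨rfl, rfl⟩
    rfl

/-- Two translated hyperplanes of one prime have the same index only if they are equal. -/
theorem X_add_C_eq_of_mem_of_mem (x : P n K) {k : Fin (n + 1)} {a a' : K} (ha : (X k + C a : A n K) ∈ x.asIdeal)
    (ha' : (X k + C a' : A n K) ∈ x.asIdeal) : a = a' := by
  have h := x.asIdeal.sub_mem ha ha'
  rw [add_sub_add_left_eq_sub, ← C_sub, C_mem_asIdeal_iff, sub_eq_zero] at h
  exact h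

end Bookkeeping

variable {T : Finset (Fin 4)} {i j : Fin 4} {b d : Fin 4 → K}

/-- `∂Qᵢ/∂yᵢ = y_j` for the far quadric `Qᵢ = (yᵢ + bᵢ)·y_j + dᵢ` (`i ≠ j`). -/
theorem pderiv_quadric_self (hij : i ≠ j) :
    pderiv i.succ ((X i.succ + C (b i)) * X j.succ + C (d i) : A 4 K) = X j.succ := by
  classical
  rw [map_add, pderiv_C, add_zero, Derivation.leibniz, smul_eq_mul, smul_eq_mul, pderiv_X_add_C, if_pos rfl, pderiv_X,
    Pi.single_apply, if_neg (fun e => hij (Fin.succ_injective _ e).symm), mul_zero, zero_add, mul_one]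

/-- `∂Qᵢ/∂y_j = yᵢ + bᵢ` (`i ≠ j`). -/
theorem pderiv_quadric_j (hij : i ≠ j) :
    pderiv j.succ ((X i.succ + C (b i)) * X j.succ + C (d i) : A 4 K) = X i.succ + C (b i) := by
  classical
  rw [map_add, pderiv_C, add_zero, Derivation.leibniz, smul_eq_mul, smul_eq_mul, pderiv_X_add_C,
    if_neg (fun e => hij (Fin.succ_injective _ e).symm), pderiv_X, Pi.single_apply, if_pos rfl, mul_one, mul_zero, add_zero]

/-- `∂Qᵢ/∂y_m = 0` for every other variable `y_m`. -/
theorem pderiv_quadric_of_ne {m : Fin (4 + 1)} (hmi : m ≠ i.succ) (hmj : m ≠ j.succ) :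
    pderiv m ((X i.succ + C (b i)) * X j.succ + C (d i) : A 4 K) = 0 := by
  classical
  rw [map_add, pderiv_C, add_zero, Derivation.leibniz, smul_eq_mul, smul_eq_mul, pderiv_X_add_C, if_neg hmi, pderiv_X,
    Pi.single_apply, if_neg (Ne.symm hmj), mul_zero, mul_zero, add_zero]

/-- The far quadric `Qᵢ` is not a translated hyperplane (`∂²Qᵢ/∂yᵢ∂y_j = 1`). -/
theorem quadric_ne_X_add_C (hij : i ≠ j) (k : Fin (4 + 1)) (a : K) :
    ((X i.succ + C (b i)) * X j.succ + C (d i) : A 4 K) ≠ X k + C a := by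
  intro h
  have h1 := congrArg (fun q : A 4 K => pderiv j.succ (pderiv i.succ q)) h
  rw [pderiv_quadric_self hij, pderiv_X_self, pderiv_X_add_C] at h1
  by_cases hik : i.succ = k
  · rw [if_pos hik, Derivation.map_one_eq_zero] at h1
    exact one_ne_zero h1
  · rw [if_neg hik, map_zero] at h1
    exact one_ne_zero h1

/-- Far quadrics are determined by their index (`i, k ≠ j`). -/
theorem quadric_eq_quadric_iff {k : Fin 4} (hij : i ≠ j) (hkj : k ≠ j) :
    ((X i.succ + C (b i)) * X j.succ + C (d i) : A 4 K) = (X k.succ + C (b k)) * X j.succ + C (d k) ↔ i = k := by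
  refine ⟨fun h => ?_, fun e => by subst e; rfl⟩
  by_contra hik
  have h1 := congrArg (pderiv i.succ) h
  rw [pderiv_quadric_self hij, pderiv_quadric_of_ne (fun e => hik (Fin.succ_injective _ e)) (fun e => hij (Fin.succ_injective _ e))]
    at h1
  exact X_ne_zero _ h1

/-- On `V(Qᵢ)` the variable `y_j` is a unit: `Qᵢ ∈ 𝔭 → y_j ∉ 𝔭` (`dᵢ ≠ 0`). -/
theorem X_j_not_mem_of_quadric_mem (x : P 4 K) {i : Fin 4} (hd : d i ≠ 0)
    (hQ : ((X i.succ + C (b i)) * X j.succ + C (d i) : A 4 K) ∈ x.asIdeal) : (X j.succ : A 4 K) ∉ x.asIdeal := by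
  intro hXj
  have h := x.asIdeal.sub_mem hQ (x.asIdeal.mul_mem_left (X i.succ + C (b i)) hXj)
  rw [add_sub_cancel_left, C_mem_asIdeal_iff] at h
  exact hd h

/-- On `V(Qᵢ)` the factor `yᵢ + bᵢ` is a unit: `Qᵢ ∈ 𝔭 → yᵢ + bᵢ ∉ 𝔭`. -/
theorem X_add_C_not_mem_of_quadric_mem (x : P 4 K) {i : Fin 4} (hd : d i ≠ 0)
    (hQ : ((X i.succ + C (b i)) * X j.succ + C (d i) : A 4 K) ∈ x.asIdeal) : (X i.succ + C (b i) : A 4 K) ∉ x.asIdeal := by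
  intro hX
  have h := x.asIdeal.sub_mem hQ (x.asIdeal.mul_mem_right (X j.succ) hX)
  rw [add_sub_cancel_left, C_mem_asIdeal_iff] at h
  exact hd h

/-- **The height of an active quadric.** If `yᵢ ∈ 𝔭` and `Qᵢ ∈ 𝔭` then `bᵢ·y_j + dᵢ ∈ 𝔭` (and `bᵢ ≠ 0`). -/
theorem C_mul_X_add_C_mem_of_quadric_mem (x : P 4 K) {i : Fin 4} (hd : d i ≠ 0)
    (hQ : ((X i.succ + C (b i)) * X j.succ + C (d i) : A 4 K) ∈ x.asIdeal) (hXi : (X i.succ : A 4 K) ∈ x.asIdeal) :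
    (C (b i) * X j.succ + C (d i) : A 4 K) ∈ x.asIdeal ∧ b i ≠ 0 := by
  have h : (C (b i) * X j.succ + C (d i) : A 4 K) ∈ x.asIdeal := by
    have h1 := x.asIdeal.sub_mem hQ (x.asIdeal.mul_mem_right (X j.succ) hXi)
    have e : ((X i.succ + C (b i)) * X j.succ + C (d i) - X i.succ * X j.succ : A 4 K) = C (b i) * X j.succ + C (d i) := by
      ring
    rwa [e] at h1
  refine ⟨h, fun hb => hd ?_⟩
  rw [hb, C_0, zero_mul, zero_add, C_mem_asIdeal_iff] at h
  exact h

/-- **Equal heights.** A far hyperplane `y_j + a` through a point of `V(yᵢ) ∩ V(Qᵢ)` has `a·bᵢ = dᵢ`. -/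
theorem height_eq_of_X_add_C_mem (x : P 4 K) {i : Fin 4} (hd : d i ≠ 0)
    (hQ : ((X i.succ + C (b i)) * X j.succ + C (d i) : A 4 K) ∈ x.asIdeal) (hXi : (X i.succ : A 4 K) ∈ x.asIdeal)
    {a : K} (ha : (X j.succ + C a : A 4 K) ∈ x.asIdeal) : a * b i = d i := by
  obtain ⟨h, -⟩ := C_mul_X_add_C_mem_of_quadric_mem x hd hQ hXi
  have h1 := x.asIdeal.sub_mem h (x.asIdeal.mul_mem_left (C (b i)) ha)
  have e : (C (b i) * X j.succ + C (d i) - C (b i) * (X j.succ + C a) : A 4 K) = C (d i - a * b i) := by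
    simp only [C_sub, C_mul]; ring
  rw [e, C_mem_asIdeal_iff, sub_eq_zero] at h1
  exact h1.symm

/-- **Equal heights, twin form.** Two active quadrics through one point of the centre have `dᵢ·b_k = d_k·bᵢ`. -/
theorem height_eq_of_quadric_mem_of_quadric_mem (x : P 4 K) {i k : Fin 4} (hdi : d i ≠ 0) (hdk : d k ≠ 0)
    (hQi : ((X i.succ + C (b i)) * X j.succ + C (d i) : A 4 K) ∈ x.asIdeal) (hXi : (X i.succ : A 4 K) ∈ x.asIdeal)
    (hQk : ((X k.succ + C (b k)) * X j.succ + C (d k) : A 4 K) ∈ x.asIdeal) (hXk : (X k.succ : A 4 K) ∈ x.asIdeal) :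
    d i * b k = d k * b i := by
  obtain ⟨hi, -⟩ := C_mul_X_add_C_mem_of_quadric_mem x hdi hQi hXi
  obtain ⟨hk, -⟩ := C_mul_X_add_C_mem_of_quadric_mem x hdk hQk hXk
  have h1 := x.asIdeal.sub_mem (x.asIdeal.mul_mem_left (C (b k)) hi) (x.asIdeal.mul_mem_left (C (b i)) hk)
  have e : (C (b k) * (C (b i) * X j.succ + C (d i)) - C (b i) * (C (b k) * X j.succ + C (d k)) : A 4 K) =
      C (d i * b k - d k * b i) := by
    simp only [C_sub, C_mul]; ring
  rw [e, C_mem_asIdeal_iff, sub_eq_zero] at h1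
  exact h1

/-! ## §2 The far good chart -/

/-- **THE FAR GOOD CHART (S3-N2 positive side with far members, `x_j`-chart, escaping case `j ∉ T`).** Hyperplanes `(y_k + a)·𝒪`
for `(k, a)` in any finite set `H`, far quadrics `Qᵢ = ((yᵢ + bᵢ)·y_j + dᵢ)·𝒪` for `i` in a finite set `fs ∌ j` (`dᵢ ≠ 0`), subject
to (C1) `(i⁺, a) ∈ H → a = bᵢ` for `i ∈ fs`, (C2) `a·bᵢ ≠ dᵢ` for `(j⁺, a) ∈ H`, `i ∈ fs ∩ T`, `bᵢ ≠ 0`, (C3) `dᵢ·b_k ≠ d_k·bᵢ`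
for `i ≠ k` in `fs ∩ T` with `bᵢ, b_k ≠ 0`: every list `E` of such members (and `⊤`'s) has `HasSNCWith E (𝓘Λ 4 K ({0} ∪ T⁺))`. -/
theorem hasSNCWith_𝓘Λ_of_forall_mem_far (hjT : j ∉ T) (H : Finset (Fin (4 + 1) × K)) (fs : Finset (Fin 4))
    (hjfs : j ∉ fs) (hd : ∀ i ∈ fs, d i ≠ 0) (hC1 : ∀ i ∈ fs, ∀ a : K, (i.succ, a) ∈ H → a = b i)
    (hC2 : ∀ i ∈ fs, i ∈ T → b i ≠ 0 → ∀ a : K, (j.succ, a) ∈ H → a * b i ≠ d i)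
    (hC3 : ∀ i ∈ fs, ∀ k ∈ fs, i ≠ k → i ∈ T → k ∈ T → b i ≠ 0 → b k ≠ 0 → d i * b k ≠ d k * b i)
    {E : List (Scheme.IdealSheafData (P 4 K))}
    (hE : ∀ D ∈ E, D = ⊤ ∨ (∃ ka ∈ H, D = ofIdealTop (Ideal.span {(γ 4 K).symm (X ka.1 + C ka.2)})) ∨
      ∃ i ∈ fs, D = ofIdealTop (Ideal.span {(γ 4 K).symm ((X i.succ + C (b i)) * X j.succ + C (d i))})) :
    HasSNCWith E (AffineCoordBlowup.𝓘Λ 4 K (insert 0 (Fin.succ '' (T : Set (Fin 4))))) := by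
  classical
  set Λ : Set (Fin (4 + 1)) := insert 0 (Fin.succ '' (T : Set (Fin 4))) with hΛ
  -- the equations
  let hyp : Fin (4 + 1) × K → A 4 K := fun ka => X ka.1 + C ka.2
  let Q : Fin 4 → A 4 K := fun i => (X i.succ + C (b i)) * X j.succ + C (d i)
  let Φ : Finset (A 4 K) := H.image hyp ∪ fs.image Q
  -- owners and ranks
  let act : P 4 K → Fin 4 → Prop := fun x i => i.succ ∈ Λ ∧ ∀ k ∈ Λ, (X k : A 4 K) ∈ x.asIdeal
  let v : P 4 K → A 4 K → Fin (4 + 1) := fun x q =>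
    if h : ∃ ka : Fin (4 + 1) × K, q = hyp ka then h.choose.1
    else if h' : ∃ i : Fin 4, i ≠ j ∧ q = Q i then (if act x h'.choose then j.succ else h'.choose.succ) else 0
  let ρ : P 4 K → A 4 K → ℕ := fun x q =>
    if ∃ ka : Fin (4 + 1) × K, q = hyp ka then 0
    else if h' : ∃ i : Fin 4, i ≠ j ∧ q = Q i then (if act x h'.choose then 1 else 2) else 0
  -- evaluation of owners and ranks
  have hv_hyp : ∀ x (k : Fin (4 + 1)) (a : K), v x (X k + C a) = k := by
    intro x k a
    have h : ∃ ka : Fin (4 + 1) × K, (X k + C a : A 4 K) = hyp ka := ⟨(k, a), rfl⟩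
    simp only [v, dif_pos h]
    have h2 := h.choose_spec
    exact (X_add_C_eq_X_add_C_iff.mp h2).1.symm
  have hρ_hyp : ∀ x (k : Fin (4 + 1)) (a : K), ρ x (X k + C a) = 0 := by
    intro x k a
    have h : ∃ ka : Fin (4 + 1) × K, (X k + C a : A 4 K) = hyp ka := ⟨(k, a), rfl⟩
    simp only [ρ, if_pos h]
  have hQne : ∀ i, i ≠ j → ¬ ∃ ka : Fin (4 + 1) × K, Q i = hyp ka := by
    rintro i hij ⟨ka, hka⟩
    exact quadric_ne_X_add_C hij ka.1 ka.2 hka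
  have hQch : ∀ i, i ≠ j → ∀ h' : ∃ i' : Fin 4, i' ≠ j ∧ Q i = Q i', h'.choose = i := by
    intro i hij h'
    obtain ⟨h1, h2⟩ := h'.choose_spec
    exact ((quadric_eq_quadric_iff hij h1).mp h2).symm
  have hv_Q : ∀ x i, i ≠ j → v x (Q i) = if act x i then j.succ else i.succ := by
    intro x i hij
    have h' : ∃ i' : Fin 4, i' ≠ j ∧ Q i = Q i' := ⟨i, hij, rfl⟩
    simp only [v, dif_neg (hQne i hij), dif_pos h', hQch i hij h']
  have hρ_Q : ∀ x i, i ≠ j → ρ x (Q i) = if act x i then 1 else 2 := by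
    intro x i hij
    have h' : ∃ i' : Fin 4, i' ≠ j ∧ Q i = Q i' := ⟨i, hij, rfl⟩
    simp only [ρ, if_neg (hQne i hij), dif_pos h', hQch i hij h']
  -- classification of the family at a point
  have hcases : ∀ (x : P 4 K) (q : A 4 K),
      (q ∈ Φ ∧ q ∈ x.asIdeal ∨ (∃ i ∈ Λ, q = X i) ∧ ∀ k ∈ Λ, (X k : A 4 K) ∈ x.asIdeal) →
        (∃ (k : Fin (4 + 1)) (a : K), q = X k + C a ∧ ((k, a) ∈ H ∨ a = 0 ∧ k ∈ Λ ∧ ∀ k ∈ Λ, (X k : A 4 K) ∈ x.asIdeal)) ∨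
        ∃ i ∈ fs, q = Q i := by
    rintro x q (⟨hq, -⟩ | ⟨⟨i, hi, rfl⟩, hΛx⟩)
    · rcases Finset.mem_union.mp hq with hq | hq
      · obtain ⟨ka, hka, rfl⟩ := Finset.mem_image.mp hq
        exact Or.inl ⟨ka.1, ka.2, rfl, Or.inl hka⟩
      · obtain ⟨i, hi, rfl⟩ := Finset.mem_image.mp hq
        exact Or.inr ⟨i, hi, rfl⟩
    · exact Or.inl ⟨i, 0, by rw [C_0, add_zero], Or.inr ⟨rfl, hi, hΛx⟩⟩
  have hmemΛ : ∀ i : Fin 4, i.succ ∈ Λ ↔ i ∈ T := by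
    intro i
    rw [hΛ, Set.mem_insert_iff, Set.mem_image]
    constructor
    · rintro (h | ⟨k, hk, hki⟩)
      · exact absurd h (Fin.succ_ne_zero i)
      · rwa [← Fin.succ_injective _ hki]
    · exact fun h => Or.inr ⟨i, h, rfl⟩
  have hjΛ : j.succ ∉ Λ := fun h => hjT ((hmemΛ j).mp h)
  refine hasSNCWith_𝓘Λ_of_jacobian E Λ Φ ?_ ρ v ?_ ?_
  · -- the members
    intro D hD
    rcases hE D hD with h | ⟨ka, hka, h⟩ | ⟨i, hi, h⟩
    · exact Or.inl h
    · exact Or.inr ⟨hyp ka, Finset.mem_union_left _ (Finset.mem_image_of_mem _ hka), h⟩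
    · exact Or.inr ⟨Q i, Finset.mem_union_right _ (Finset.mem_image_of_mem _ hi), h⟩
  · -- diagonal: every equation owns a variable with unit derivative
    intro x q hq
    have hq𝔭 : q ∈ x.asIdeal := by
      rcases hq with ⟨-, h⟩ | ⟨⟨i, hi, rfl⟩, h⟩
      · exact h
      · exact h i hi
    rcases hcases x q hq with ⟨k, a, rfl, -⟩ | ⟨i, hi, rfl⟩
    · rw [hv_hyp, pderiv_X_add_C, if_pos rfl]
      exact fun h1 => x.2.ne_top ((Ideal.eq_top_iff_one _).mpr h1)
    · have hij : i ≠ j := fun e => hjfs (e ▸ hi)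
      rw [hv_Q x i hij]
      by_cases hact : act x i
      · rw [if_pos hact, pderiv_quadric_j hij]
        exact X_add_C_not_mem_of_quadric_mem x (hd i hi) hq𝔭
      · rw [if_neg hact, pderiv_quadric_self hij]
        exact X_j_not_mem_of_quadric_mem x (hd i hi) hq𝔭
  · -- triangularity: an earlier equation does not involve a later equation's variable (modulo 𝔭)
    intro x q q' hq hq' hne hρle
    have hq𝔭 : q ∈ x.asIdeal := by
      rcases hq with ⟨-, h⟩ | ⟨⟨i, hi, rfl⟩, h⟩
      · exact h
      · exact h i hi
    have hq'𝔭 : q' ∈ x.asIdeal := by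
      rcases hq' with ⟨-, h⟩ | ⟨⟨i, hi, rfl⟩, h⟩
      · exact h
      · exact h i hi
    rcases hcases x q hq with ⟨k, a, rfl, hka⟩ | ⟨i, hi, rfl⟩
    · -- `q` a hyperplane `y_k + a`: the owner of `q'` must differ from `k`
      rw [pderiv_X_add_C]
      rcases hcases x q' hq' with ⟨k', a', rfl, hka'⟩ | ⟨i', hi', rfl⟩
      · rw [hv_hyp]
        by_cases hkk : k' = k
        · subst hkk
          exact absurd (by rw [X_add_C_eq_of_mem_of_mem x hq𝔭 hq'𝔭]) hne
        · rw [if_neg hkk]; exact x.asIdeal.zero_mem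
      · have hij' : i' ≠ j := fun e => hjfs (e ▸ hi')
        rw [hv_Q x i' hij']
        by_cases hact : act x i'
        · rw [if_pos hact]
          by_cases hkj : j.succ = k
          · -- a far hyperplane `y_j + a` and an active quadric: equal heights, excluded by (C2)
            exfalso
            subst hkj
            have hXi : (X i'.succ : A 4 K) ∈ x.asIdeal := hact.2 _ hact.1
            have hiT : i' ∈ T := (hmemΛ i').mp hact.1
            have hbi : b i' ≠ 0 := (C_mul_X_add_C_mem_of_quadric_mem x (hd i' hi') hq'𝔭 hXi).2
            have haH : (j.succ, a) ∈ H := by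
              rcases hka with h | ⟨-, h, -⟩
              · exact h
              · exact absurd h hjΛ
            exact hC2 i' hi' hiT hbi a haH (height_eq_of_X_add_C_mem x (hd i' hi') hq'𝔭 hXi hq𝔭)
          · rw [if_neg hkj]; exact x.asIdeal.zero_mem
        · rw [if_neg hact]
          by_cases hki : i'.succ = k
          · -- a hyperplane of the quadric's own index: constant `bᵢ` by (C1), or the centre variable (then active)
            exfalso
            subst hki
            rcases hka with h | ⟨rfl, hmem, hall⟩
            · have ha := hC1 i' hi' a h
              subst ha
              exact X_add_C_not_mem_of_quadric_mem x (hd i' hi') hq'𝔭 hq𝔭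
            · exact hact ⟨hmem, hall⟩
          · rw [if_neg hki]; exact x.asIdeal.zero_mem
    · -- `q` a quadric `Qᵢ`
      have hij : i ≠ j := fun e => hjfs (e ▸ hi)
      rcases hcases x q' hq' with ⟨k', a', rfl, -⟩ | ⟨i', hi', rfl⟩
      · -- a hyperplane has rank 0 < rank of a quadric
        exfalso
        rw [hρ_hyp, hρ_Q x i hij] at hρle
        split_ifs at hρle <;> omega
      · have hij' : i' ≠ j := fun e => hjfs (e ▸ hi')
        have hii' : i ≠ i' := fun e => hne (by rw [e])
        rw [hv_Q x i' hij']
        by_cases hact' : act x i'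
        · -- `Qᵢ'` active of rank 1 ≥ rank `Qᵢ`: so `Qᵢ` is active too, and the heights agree — excluded by (C3)
          exfalso
          have hact : act x i := by
            rw [hρ_Q x i hij, hρ_Q x i' hij', if_pos hact'] at hρle
            by_contra h
            rw [if_neg h] at hρle
            omega
          have hXi : (X i.succ : A 4 K) ∈ x.asIdeal := hact.2 _ hact.1
          have hXi' : (X i'.succ : A 4 K) ∈ x.asIdeal := hact'.2 _ hact'.1
          have hbi : b i ≠ 0 := (C_mul_X_add_C_mem_of_quadric_mem x (hd i hi) hq𝔭 hXi).2
          have hbi' : b i' ≠ 0 := (C_mul_X_add_C_mem_of_quadric_mem x (hd i' hi') hq'𝔭 hXi').2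
          exact hC3 i hi i' hi' hii' ((hmemΛ i).mp hact.1) ((hmemΛ i').mp hact'.1) hbi hbi'
            (height_eq_of_quadric_mem_of_quadric_mem x (hd i hi) (hd i' hi') hq𝔭 hXi hq'𝔭 hXi')
        · rw [if_neg hact', pderiv_quadric_of_ne (fun e => hii' (Fin.succ_injective _ e).symm)
            (fun e => hij' (Fin.succ_injective _ e))]
          exact x.asIdeal.zero_mem

end ChartDictionary

end Summit.ResolutionOfSingularities.ResolutionOfSingularities.Theorems.PIDim4

end
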